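import Summits.KontsevichZagierPeriods.KontsevichZagierPeriods.Theses.IsogenyCertificates
import Summits.KontsevichZagierPeriods.KontsevichZagierPeriods.Theorems.XMapKernel.Negative.Core
import Literature.NumberTheory.Transcendental.KZSubcalculusInvariants
import Literature.NumberTheory.Transcendental.KZLogCalculusProofs

/-!
# Disproof of `BiellipticRealPeriodCell` (crux stmt-KontsevichZagierPeriods-18685) — findings

Standing-adversary work file (cdisprove seat `refuter-cdisprove-stmt-KontsevichZagierPeriods-18685-0`,
route IsogenyCertificates, rank-8 crux; cycle 1, 2026-08-17). Prose only in docstrings; every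
`theorem` below is checked (`lean check` rc 0); no `sorry` remains (cycle-1 end state).

**VERDICT (cycle 1): NO KILL, and no statement-level kill exists.** The crux is Conjecture 1 in
kernel form restricted to the bielliptic sector; the kernel conjecture is the summit
(`kzKernelConjecture_iff_isRational`, tree), so `of_summit` (§1): the summit IMPLIES the crux outright,
and a Lean refutation `¬ BiellipticRealPeriodCell` would be a refutation of the formalised
Kontsevich–Zagier conjecture on a sector of REAL 1-PERIODS OF ELLIPTIC CURVES OVER `ℚ` — exactly the
sector where Huber–Wüstholz (HW2022 Thm 13.3/15.3, in the tree as `HuberWustholzManyCurvePeriods_holds`)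
says every `ℚ̄`-linear relation is motivic (isogenies between the two elliptic quotients
`E₁ : y² = G(u)`, `E₂ : w² = u³G(1/u)`), and the route's LANDED cell (i)
(`XMapKernelCells.realPeriodCellKernel_relations`) already realises those as move chains. No
separating invariant (§3 template) can exist unless HW or the landed cell is wrong.

## Findings (index)
* **F1 strength** (§1): `of_kzKernelConjecture`, `of_summit`, `not_summit_of_not`, `of_genusTwoGens`
  (the sibling crux `GenusTwoRealPeriodCell` ⇒ crux by closure monotonicity, `F := G ∘ X²`).
  LANDING as `Theorems/BiellipticRealPeriodCell/Negative/Core.lean` (p142361, subgroup-inequality form: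
  `summit_iff_ker_le`, `inf_le_of_ker_le`, `crux_iff_inf_le`, `biellGens_subset_genusTwoGens`).
* **F2 hypothesis mutation** (§2): each of `IsBounded`, `Squarefree`, `natDegree = 3` dropped gives a
  statement SANDWICHED between the crux and Conjecture 1 (`without*_of_kzKernelConjecture`,
  `of_without*`): NO `_false_without_` theorem for them exists short of `¬` Conjecture 1 — they are
  METHOD-bearing, not truth-bearing. `0 < G(q²)` is pure decoration (`withoutPos_iff`: the extra
  generators have EMPTY domain, `connectedComponentIn_eq_empty` + `KZ.of_mem_relations_of_volume_eq_zero`).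
  LANDING in Core.lean (`biellGens_subset_without*`, `withoutPos_inf_le_iff`).
* **F3 why `IsBounded` is method-bearing** (§2b, proved here): for `G = (u−1)(u−4)(u−9)` the sextic
  `G(x²)` has the UNBOUNDED component `(3,∞)`; its `a₀`-part goes under `v = 1/x²` to `(0, 1/9)`
  (`image_inv_sq_Ioi_three`), which is a PROPER part of the component of `{G* > 0}`
  (`G*(v) = (1−v)(1−4v)(1−9v) > 0` on all of `(−∞, 1/9)`, in particular at `v = 0` and `v = −1`:
  `reversed_pos_zero`, `reversed_pos_neg_one`, `Ioo_subset_reversed_pos`) — an INCOMPLETE elliptic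
  integral of `E₂` (elliptic logarithm of the point `v = 0`), a 1-motive period outside every
  elliptic cell of the route. Dropping `IsBounded` keeps the statement true-iff-KZ but kills the line.
* **F4 load-bearing MOVES** (proved in the Negative lane, part 1 `Witnesses.lean` p142876, part 2
  `LoadBearing.lean` p143399, both ACCEPTED; witnesses on `y² = −(x²−1)(x²−4)(x²−9)`,
  components `K₀ = (−1,1)`, `K₊ = (2,3)`, `K₋ = (−3,−2)`):
  `false_without_eval` (`[K₊, 1/√F₀]` has value `∫₂³ dx/√F₀ > 0`: the sector is not degenerate);
  `false_without_additivity` — ANY PROOF MUST USE (1a) OR (1b): the SINGLE generator `[K₀, x/√F₀]`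
  has value `0` (odd) but `KZ.coeffSum = 1`, which rules (2)+(3) preserve; this is precisely the
  through-zero odd part the crux's why-might-fail names ("the a₁-part must cancel formally");
  `false_without_cov_nl` — ANY PROOF MUST MOVE MASS ACROSS `x = 0` (rule (2) or (3)): the mirror pair
  `[K₊,1/√F₀] − [K₋,1/√F₀]` has value `0` but `KZ.restrictedEval` over `{x<0}` equal to
  `−∫₂³ dx/√F₀ ≠ 0`, which (1a)+(1b) preserve.
* **F5 refuted natural strengthening** (LoadBearing.lean): `not_value_ne_zero_of_nondegenerate` — a
  generator with `(a₀,a₁) ≠ (0,0)` CAN have value `0` (`[K₀, x/√F₀]`); so the sector's kernel is NOT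
  spanned by differences of equal-valued generators, and any generatorwise transfer (the two idea
  cards' `C⁺`) must send such a generator to an honest RELATION, not to a cell-(i) generator.
  `exists_kernel_single_ne_zero`, `exists_kernel_pair_ne_zero`: the kernel is non-trivial in both
  shapes (odd central generator; mirror pair outside the additive sub-calculus).
* **F6 rule (2), change of variables, is load-bearing — PROVED UNCONDITIONALLY** (Negative lane parts
  3–5: `NoChangeOfVariables.lean` p143989, `LemniscaticWitness.lean` p143785, `LemniscaticValue.lean`
  p143789 — all ACCEPTED; axioms `propext/Classical.choice/Quot.sound`): `false_without_changeOfVariables :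
  ¬ (crux with relations := closure((1a) ∪ (1b) ∪ (3)))`. Invariant (part 3): `KZ.restrictedEval` over
  the FIRST-COORDINATE windows `W n = {x | ∀ i, i = 0 → x i < 0}` read modulo real algebraic numbers —
  (1a),(1b) give `0` (tree); an NL pair of level `≥ 1` restricts to an NL pair (`restrictedEval_nl_succ`:
  the window binds `x 0`, rule (3) integrates `x last`, `(init z) 0 = z 0`) hence `0`; an NL pair of
  level `0` has ALGEBRAIC restricted value (`restrictedEval_nl_zero_isAlgebraic`: FTC on the clamped
  band `[a₀, min(b₀,0)]`, Dirac volume on `ℝ⁰`, `IsSemialgebraicFunOn.isAlgebraic_apply`); so the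
  whole change-of-variables-free sub-calculus has algebraic restricted values
  (`isAlgebraic_restrictedEval_of_mem_closure_noCoV`). Witness (parts 4–5): the LEMNISCATIC bielliptic
  curve `y² = (x²−1)(x²−25)(x²−49)` (`1, 25, 49` squares in arithmetic progression ⇒ the odd quotient is
  the twist by `24` of `y² = x³ − x`): the odd pair `[(1,5), x/√F₁] + [(−5,−1), x/√F₁]` has value `0`
  and restricted value `−V`, `V = ∫₁⁵ x dx/√F₁ = ϖ/(2√24)` (`lemV_eq`: `u = x²`, `u = 24X+25`, tree
  `integral_Ioo_neg_one_zero`), and `ϖ = Γ(1/4)²/(2√(2π))` is TRANSCENDENTAL (`transcendental_halfLem`: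
  the tree's `HuberWustholzManyCurvePeriods_holds` with one curve, the lemniscatic period pair
  `exists_lemniscatic_periodPair` — Schneider's theorem). The first witness curve of part 1 gives the
  same conclusion modulo the transcendence of its own half-period
  (`false_without_changeOfVariables_of_transcendental`). With F4: ANY PROOF OF THE CRUX USES AN
  ADDITIVITY RULE AND A CHANGE OF VARIABLES; Newton–Leibniz can replace neither.
* Targets: none (payload.targets = ∅, no line picked yet). Both round-1 idea cards
  (`quotient-pushforward`, `sextic-xmap-data-pushforward`) were read against F2–F5: their transfer
  statements are themselves summit-implied (value identities are calculus facts), so nothing there is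
  refutable either; their first lemmas (`OddPartPushforward`, `EvenPartPushforwardRay`,
  `SexticCellMove`) are honest `changeOfVariablesRel` instances (Jacobian identities checked on paper:
  `(a₁/2)/√G(x²)·|2x| = a₁x/√G(x²)` for `x>0`; `(a₀/2)/√G*(1/x²)·|−2/x³| = a₀/√G(x²)` since
  `√G*(1/x²) = x⁻³√G(x²)`), consistent with F4 (they use rule (2)) and F5 (the odd central generator is
  sent to `0` by dissection + reflection + (1b), not transferred).

## Attack log (why it resists)
* small / finite models: none — honest Lebesgue integrals of semialgebraic functions; nothing decidable.
* degenerate instances: `a₀ = a₁ = 0` (zero integrand: a relation by (1b),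
  `KZ.of_mem_relations_of_eqOn_zero`); `G(q²) ≤ 0` (empty component: relation, F2); `G(0) = 0`
  excluded by `Squarefree` (`coeff_zero_ne_zero_of_squarefree`, Core.lean §4) so no component ends at
  `0`; `lc G < 0` (no unbounded component at all — the witness curve of F4); all derivable or excluded.
* counterexample search: the planner's and the one-shot refuter's numerics (item evidence
  `bielliptic_check_float.py`, kit j022428: Jacobi identities to ≤ 6·10⁻²³ and a 60-component sweep;
  ideator k1: 79 identities ≤ 3·10⁻¹⁵; ideator k2: kit j022603) confirm the two-quotient reduction on
  every component type; by HW no `ℤ`-relation among the resulting elliptic periods exists beyond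
  isogenies, so a PSLQ hunt could only rediscover a theorem — not run again.
* barrier catalogue (`Literature/Barriers/KontsevichZagierPeriods/`): `GrothendieckPeriodConjectureDependence*`
  (strength of kernel statements) — this sector is the PROVED corner of GPC (1-motives, HW), so the
  barrier does not bite; `AlgebraicPrimitivesObstruction` / `HauptvermutungObstruction` concern proof
  techniques (rule (3) primitives; global semialgebraic maps in dim ≥ 5) — the lines use rule (2) in
  dimension 1 only; `PeriodEqualityDecidability` — consistent (1-periods: Sertöz–Ouaknine–Worrell decide
  equality). negatives index (`ledger negatives`): 1 entry (KinematicFormulas convexity), unrelated.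
* print: Jacobi/Legendre reduction of `∫(a₀+a₁x)dx/√G(x²)` to `E₁ × E₂` is classical (Kuhn 1988,
  Frey–Kani 1991, Shaska–Völklein 2001 §2, Cassels–Flynn ch. 14); no counterexample literature exists
  for relations among real periods of elliptic curves over `ℚ` (they are governed by HW2022 Thm 15.3).
-/

noncomputable section

-- The crux-workfile namespace `Summit.<P>.<Sub>.Cruxes.<Crux>.Disproof` is prescribed by the cdisprove protocol and
-- repeats the summit name (single-conjunct summit: Sub = Summit); silence only that linter.
set_option linter.dupNamespace false

namespace Summit.KontsevichZagierPeriods.KontsevichZagierPeriods.Cruxes.BiellipticRealPeriodCell.Disproof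

open Literature.NumberTheory.Transcendental
open Summit.KontsevichZagierPeriods.KontsevichZagierPeriods.Theses.IsogenyCertificates
open Summit.KontsevichZagierPeriods.XMapKernel.Negative (summit_iff_kzKernelConjecture)
open Set MeasureTheory Polynomial

/-! ## §0 Vocabulary -/

/-- The generating set of the bielliptic sector, verbatim from the crux. -/
def biellGens : Set KZ.FormalRep :=
  {d | ∃ (G : Polynomial ℚ) (q a₀ a₁ : ℚ) (r : KZ.IntegralRep 1), G.natDegree = 3 ∧
    Squarefree (G.comp (Polynomial.X ^ 2)) ∧ 0 < Polynomial.aeval (q : ℝ) (G.comp (Polynomial.X ^ 2)) ∧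
    Bornology.IsBounded (connectedComponentIn {y : ℝ | 0 < Polynomial.aeval y (G.comp (Polynomial.X ^ 2))} (q : ℝ)) ∧
    r.domain = {x | x 0 ∈ connectedComponentIn {y : ℝ | 0 < Polynomial.aeval y (G.comp (Polynomial.X ^ 2))} (q : ℝ)} ∧
    Set.EqOn r.integrand (fun x => ((a₀ : ℝ) + (a₁ : ℝ) * x 0) /
      Real.sqrt (Polynomial.aeval (x 0) (G.comp (Polynomial.X ^ 2)))) r.domain ∧
    d = KZ.of r}

/-- The crux, unfolded (`Iff.rfl` read-back: no coercion surprises, no junk operator — `Real.sqrt`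
is only met where its argument is positive, `/` only with positive denominators on the domain). -/
theorem crux_iff : BiellipticRealPeriodCell ↔
    ∀ c ∈ AddSubgroup.closure biellGens, KZ.eval c = 0 → c ∈ KZ.relations := Iff.rfl

/-! ## §1 Strength: the summit implies the crux (F1) -/

/-- **Kernel conjecture ⇒ crux.** -/
theorem of_kzKernelConjecture (h : KZKernelConjecture) : BiellipticRealPeriodCell := fun c _ hc => h c hc

/-- **Summit ⇒ crux** (through the tree equivalence `kzKernelConjecture_iff_isRational`). -/
theorem of_summit (h : _root_.KontsevichZagierPeriods) : BiellipticRealPeriodCell :=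
  of_kzKernelConjecture (summit_iff_kzKernelConjecture.1 h)

/-- Contrapositive: **a refutation of the crux refutes the formalised period conjecture.** -/
theorem not_summit_of_not (h : ¬ BiellipticRealPeriodCell) : ¬ _root_.KontsevichZagierPeriods :=
  fun hs => h (of_summit hs)

/-- `deg (G ∘ X²) = 2 deg G`. -/
theorem natDegree_comp_X_sq (G : Polynomial ℚ) : (G.comp (Polynomial.X ^ 2)).natDegree = G.natDegree * 2 := by
  rw [Polynomial.natDegree_comp, Polynomial.natDegree_X_pow]

/-- **The genus-two cell implies the crux** (closure monotonicity with `F := G ∘ X²`; stated against the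
genus-two generating SET in the source's conjunct order, `Squarefree` first — the planner's `cell_mono`). -/
theorem of_genusTwoGens (hG : ∀ c ∈ AddSubgroup.closure {d : KZ.FormalRep | ∃ (F : Polynomial ℚ) (q a₀ a₁ : ℚ)
      (r : KZ.IntegralRep 1), Squarefree F ∧ (F.natDegree = 5 ∨ F.natDegree = 6) ∧ 0 < Polynomial.aeval (q : ℝ) F ∧
      r.domain = {x | x 0 ∈ connectedComponentIn {y : ℝ | 0 < Polynomial.aeval y F} (q : ℝ)} ∧
      Set.EqOn r.integrand (fun x => ((a₀ : ℝ) + (a₁ : ℝ) * x 0) / Real.sqrt (Polynomial.aeval (x 0) F)) r.domain ∧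
      d = KZ.of r}, KZ.eval c = 0 → c ∈ KZ.relations) : BiellipticRealPeriodCell := by
  intro c hc h0
  refine hG c (AddSubgroup.closure_mono ?_ hc) h0
  rintro d ⟨G, q, a₀, a₁, r, hdeg, hsq, hpos, -, hdom, hint, rfl⟩
  refine ⟨G.comp (Polynomial.X ^ 2), q, a₀, a₁, r, hsq, Or.inr ?_, hpos, hdom, hint, rfl⟩
  rw [natDegree_comp_X_sq, hdeg]

/-! ## §2 Hypothesis mutation (F2): every weakening is sandwiched between the crux and Conjecture 1 -/

/-- Generators WITHOUT the boundedness clause. -/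
def withoutBoundedGens : Set KZ.FormalRep :=
  {d | ∃ (G : Polynomial ℚ) (q a₀ a₁ : ℚ) (r : KZ.IntegralRep 1), G.natDegree = 3 ∧
    Squarefree (G.comp (Polynomial.X ^ 2)) ∧ 0 < Polynomial.aeval (q : ℝ) (G.comp (Polynomial.X ^ 2)) ∧
    r.domain = {x | x 0 ∈ connectedComponentIn {y : ℝ | 0 < Polynomial.aeval y (G.comp (Polynomial.X ^ 2))} (q : ℝ)} ∧
    Set.EqOn r.integrand (fun x => ((a₀ : ℝ) + (a₁ : ℝ) * x 0) /
      Real.sqrt (Polynomial.aeval (x 0) (G.comp (Polynomial.X ^ 2)))) r.domain ∧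
    d = KZ.of r}

/-- Generators WITHOUT the squarefreeness clause. -/
def withoutSquarefreeGens : Set KZ.FormalRep :=
  {d | ∃ (G : Polynomial ℚ) (q a₀ a₁ : ℚ) (r : KZ.IntegralRep 1), G.natDegree = 3 ∧
    0 < Polynomial.aeval (q : ℝ) (G.comp (Polynomial.X ^ 2)) ∧
    Bornology.IsBounded (connectedComponentIn {y : ℝ | 0 < Polynomial.aeval y (G.comp (Polynomial.X ^ 2))} (q : ℝ)) ∧
    r.domain = {x | x 0 ∈ connectedComponentIn {y : ℝ | 0 < Polynomial.aeval y (G.comp (Polynomial.X ^ 2))} (q : ℝ)} ∧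
    Set.EqOn r.integrand (fun x => ((a₀ : ℝ) + (a₁ : ℝ) * x 0) /
      Real.sqrt (Polynomial.aeval (x 0) (G.comp (Polynomial.X ^ 2)))) r.domain ∧
    d = KZ.of r}

/-- Generators WITHOUT the degree clause. -/
def withoutDegreeGens : Set KZ.FormalRep :=
  {d | ∃ (G : Polynomial ℚ) (q a₀ a₁ : ℚ) (r : KZ.IntegralRep 1),
    Squarefree (G.comp (Polynomial.X ^ 2)) ∧ 0 < Polynomial.aeval (q : ℝ) (G.comp (Polynomial.X ^ 2)) ∧
    Bornology.IsBounded (connectedComponentIn {y : ℝ | 0 < Polynomial.aeval y (G.comp (Polynomial.X ^ 2))} (q : ℝ)) ∧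
    r.domain = {x | x 0 ∈ connectedComponentIn {y : ℝ | 0 < Polynomial.aeval y (G.comp (Polynomial.X ^ 2))} (q : ℝ)} ∧
    Set.EqOn r.integrand (fun x => ((a₀ : ℝ) + (a₁ : ℝ) * x 0) /
      Real.sqrt (Polynomial.aeval (x 0) (G.comp (Polynomial.X ^ 2)))) r.domain ∧
    d = KZ.of r}

/-- Generators WITHOUT the positivity clause `0 < G(q²)`. -/
def withoutPosGens : Set KZ.FormalRep :=
  {d | ∃ (G : Polynomial ℚ) (q a₀ a₁ : ℚ) (r : KZ.IntegralRep 1), G.natDegree = 3 ∧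
    Squarefree (G.comp (Polynomial.X ^ 2)) ∧
    Bornology.IsBounded (connectedComponentIn {y : ℝ | 0 < Polynomial.aeval y (G.comp (Polynomial.X ^ 2))} (q : ℝ)) ∧
    r.domain = {x | x 0 ∈ connectedComponentIn {y : ℝ | 0 < Polynomial.aeval y (G.comp (Polynomial.X ^ 2))} (q : ℝ)} ∧
    Set.EqOn r.integrand (fun x => ((a₀ : ℝ) + (a₁ : ℝ) * x 0) /
      Real.sqrt (Polynomial.aeval (x 0) (G.comp (Polynomial.X ^ 2)))) r.domain ∧
    d = KZ.of r}

/-- `KZKernelConjecture ⇒ WithoutBounded`: so `_false_without_IsBounded` would refute Conjecture 1. -/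
theorem withoutBounded_of_kzKernelConjecture (h : KZKernelConjecture) :
    ∀ c ∈ AddSubgroup.closure withoutBoundedGens, KZ.eval c = 0 → c ∈ KZ.relations := fun c _ hc => h c hc

/-- `WithoutBounded ⇒ crux` (monotonicity). -/
theorem of_withoutBounded (h : ∀ c ∈ AddSubgroup.closure withoutBoundedGens, KZ.eval c = 0 → c ∈ KZ.relations) :
    BiellipticRealPeriodCell := fun c hc h0 =>
  h c (AddSubgroup.closure_mono (by
    rintro d ⟨G, q, a₀, a₁, r, h1, h2, h3, -, h5, h6, h7⟩; exact ⟨G, q, a₀, a₁, r, h1, h2, h3, h5, h6, h7⟩) hc) h0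

/-- `KZKernelConjecture ⇒ WithoutSquarefree`. -/
theorem withoutSquarefree_of_kzKernelConjecture (h : KZKernelConjecture) :
    ∀ c ∈ AddSubgroup.closure withoutSquarefreeGens, KZ.eval c = 0 → c ∈ KZ.relations := fun c _ hc => h c hc

/-- `WithoutSquarefree ⇒ crux`. -/
theorem of_withoutSquarefree (h : ∀ c ∈ AddSubgroup.closure withoutSquarefreeGens, KZ.eval c = 0 → c ∈ KZ.relations) :
    BiellipticRealPeriodCell := fun c hc h0 =>
  h c (AddSubgroup.closure_mono (by
    rintro d ⟨G, q, a₀, a₁, r, h1, -, h3, h4, h5, h6, h7⟩; exact ⟨G, q, a₀, a₁, r, h1, h3, h4, h5, h6, h7⟩) hc) h0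

/-- `KZKernelConjecture ⇒ WithoutDegree`. -/
theorem withoutDegree_of_kzKernelConjecture (h : KZKernelConjecture) :
    ∀ c ∈ AddSubgroup.closure withoutDegreeGens, KZ.eval c = 0 → c ∈ KZ.relations := fun c _ hc => h c hc

/-- `WithoutDegree ⇒ crux`. -/
theorem of_withoutDegree (h : ∀ c ∈ AddSubgroup.closure withoutDegreeGens, KZ.eval c = 0 → c ∈ KZ.relations) :
    BiellipticRealPeriodCell := fun c hc h0 =>
  h c (AddSubgroup.closure_mono (by
    rintro d ⟨G, q, a₀, a₁, r, -, h2, h3, h4, h5, h6, h7⟩; exact ⟨G, q, a₀, a₁, r, h2, h3, h4, h5, h6, h7⟩) hc) h0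

/-- **`0 < G(q²)` is decoration**: `WithoutPos ↔ crux`. If `G(q²) ≤ 0` the component through `q` is
empty and the representation is a relation on its own; the transfer principle does the rest. -/
theorem withoutPos_iff :
    (∀ c ∈ AddSubgroup.closure withoutPosGens, KZ.eval c = 0 → c ∈ KZ.relations) ↔ BiellipticRealPeriodCell := by
  constructor
  · intro h c hc h0
    exact h c (AddSubgroup.closure_mono (by
      rintro d ⟨G, q, a₀, a₁, r, h1, h2, -, h4, h5, h6, h7⟩; exact ⟨G, q, a₀, a₁, r, h1, h2, h4, h5, h6, h7⟩) hc) h0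
  · intro h c hc h0
    have hsub : withoutPosGens ⊆ ↑(AddSubgroup.closure biellGens ⊔ KZ.relations) := by
      rintro d ⟨G, q, a₀, a₁, r, h1, h2, h4, h5, h6, rfl⟩
      by_cases hpos : 0 < Polynomial.aeval (q : ℝ) (G.comp (Polynomial.X ^ 2))
      · exact AddSubgroup.mem_sup_left
          (AddSubgroup.subset_closure ⟨G, q, a₀, a₁, r, h1, h2, hpos, h4, h5, h6, rfl⟩)
      · refine AddSubgroup.mem_sup_right (KZ.of_mem_relations_of_volume_eq_zero r ?_)
        have hempty : connectedComponentIn {y : ℝ | 0 < Polynomial.aeval y (G.comp (Polynomial.X ^ 2))} (q : ℝ) = ∅ :=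
          connectedComponentIn_eq_empty hpos
        simp [h5, hempty]
    have hc' : c ∈ AddSubgroup.closure biellGens ⊔ KZ.relations :=
      (AddSubgroup.closure_le (K := AddSubgroup.closure biellGens ⊔ KZ.relations)).2 hsub hc
    obtain ⟨b, hb, ρ, hρ, rfl⟩ := AddSubgroup.mem_sup.1 hc'
    have hρ0 : KZ.eval ρ = 0 := AddMonoidHom.mem_ker.1 (KZ.relations_le_ker_eval_holds hρ)
    have hb0 : KZ.eval b = 0 := by rw [map_add, hρ0, add_zero] at h0; exact h0
    exact KZ.relations.add_mem (h b hb hb0) hρ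

/-! ## §2b Why `IsBounded` is METHOD-bearing (F3): unbounded components give incomplete integrals of `E₂` -/

/-- For `G = (u−1)(u−4)(u−9)` (leading coefficient `> 0`) the ray `(3, ∞)` lies in `{G(x²) > 0}`: an
UNBOUNDED component exists as soon as `IsBounded` is dropped. -/
theorem Ioi_three_subset_pos : Ioi (3:ℝ) ⊆ {x : ℝ | 0 < (x ^ 2 - 1) * (x ^ 2 - 4) * (x ^ 2 - 9)} := by
  intro x hx
  have hx3 : (3:ℝ) < x := hx
  have h1 : (0:ℝ) < x ^ 2 - 1 := by nlinarith
  have h4 : (0:ℝ) < x ^ 2 - 4 := by nlinarith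
  have h9 : (0:ℝ) < x ^ 2 - 9 := by nlinarith
  exact mul_pos (mul_pos h1 h4) h9

/-- The even part's substitution `v = 1/x²` sends the ray `(3,∞)` onto the BOUNDED interval `(0, 1/9)`. -/
theorem image_inv_sq_Ioi_three : (fun x : ℝ => 1 / x ^ 2) '' Ioi (3:ℝ) = Ioo 0 (1/9) := by
  ext v
  simp only [mem_image, mem_Ioi, mem_Ioo]
  constructor
  · rintro ⟨x, hx, rfl⟩
    have hx0 : 0 < x := by linarith
    refine ⟨by positivity, ?_⟩
    rw [div_lt_div_iff₀ (by positivity) (by norm_num)]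
    nlinarith
  · rintro ⟨hv0, hv⟩
    refine ⟨Real.sqrt (1 / v), ?_, ?_⟩
    · rw [show (3:ℝ) = Real.sqrt 9 by rw [show (9:ℝ) = 3 ^ 2 by norm_num, Real.sqrt_sq (by norm_num)]]
      apply Real.sqrt_lt_sqrt (by norm_num)
      rw [lt_div_iff₀ hv0]
      linarith [(lt_div_iff₀ (by norm_num : (0:ℝ) < 9)).1 hv]
    · rw [Real.sq_sqrt (by positivity)]
      field_simp

/-- The reversed cubic `G*(v) = v³G(1/v) = (1−v)(1−4v)(1−9v)` is positive on the whole half-line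
`(−∞, 1/9)` … -/
theorem Iio_subset_reversed_pos : Iio (1/9 : ℝ) ⊆ {v : ℝ | 0 < (1 - v) * (1 - 4 * v) * (1 - 9 * v)} := by
  intro v hv
  have hv' : v < 1/9 := hv
  have h1 : (0:ℝ) < 1 - v := by linarith
  have h2 : (0:ℝ) < 1 - 4 * v := by linarith
  have h3 : (0:ℝ) < 1 - 9 * v := by linarith
  exact mul_pos (mul_pos h1 h2) h3

/-- … in particular at `v = 0` (where `G*(0) = lc G = 1 ≠ 0`: NOT a branch point) … -/
theorem reversed_pos_zero : (0:ℝ) ∈ {v : ℝ | 0 < (1 - v) * (1 - 4 * v) * (1 - 9 * v)} := by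
  simp

/-- … and at `v = −1`, beyond the image `(0, 1/9)`: so the image of the unbounded component is a
PROPER sub-interval of a component of `{G* > 0}` — `∫₃^∞ dx/√G(x²) = ½∫₀^{1/9} dv/√G*(v)` is an
INCOMPLETE elliptic integral of `E₂ : w² = G*(v)` (the elliptic logarithm of the point above `v = 0`),
outside the real-period cell (i) and the `(ω, η)`-egg cell (ii) of the route. -/
theorem reversed_pos_neg_one : (-1:ℝ) ∈ {v : ℝ | 0 < (1 - v) * (1 - 4 * v) * (1 - 9 * v)} := by
  norm_num

/-- The image misses points of the same component on both sides' closure: `(0,1/9) ⊊ (−∞, 1/9)`. -/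
theorem image_ssubset : (fun x : ℝ => 1 / x ^ 2) '' Ioi (3:ℝ) ⊂ {v : ℝ | 0 < (1 - v) * (1 - 4 * v) * (1 - 9 * v)} := by
  rw [image_inv_sq_Ioi_three]
  refine ⟨fun v hv => Iio_subset_reversed_pos (show v < 1/9 from hv.2), fun h => ?_⟩
  have := h reversed_pos_zero
  exact lt_irrefl _ this.1

/-! ## §3 The shape of any refutation -/

/-- A refutation is exactly a value-`0` element of the sector that is not a relation. -/
theorem not_iff : ¬ BiellipticRealPeriodCell ↔ ∃ c ∈ AddSubgroup.closure biellGens, KZ.eval c = 0 ∧ c ∉ KZ.relations := by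
  simp only [crux_iff, not_forall, exists_prop]

/-- **Separating-invariant template**: an additive invariant killing the four move sets but not some
value-`0` element of the sector refutes the crux. None is known (and by HW + the landed cell none is
expected). The invariants that DO separate sub-calculi (`KZ.coeffSum`, `KZ.restrictedEval`) give F4. -/
theorem not_of_separating_invariant {A : Type*} [AddCommGroup A] (ψ : KZ.FormalRep →+ A)
    (hψ : KZ.relations ≤ ψ.ker) {c : KZ.FormalRep} (hc : c ∈ AddSubgroup.closure biellGens)
    (h0 : KZ.eval c = 0) (hψc : ψ c ≠ 0) : ¬ BiellipticRealPeriodCell :=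
  fun h => hψc (AddMonoidHom.mem_ker.1 (hψ (h c hc h0)))

/-! ## §4 Load-bearing moves and refuted strengthenings (F4, F5)

Proved in the Negative lane, ALL ACCEPTED (part 1 `Theorems/BiellipticRealPeriodCell/Negative/Witnesses.lean`
p142876 @ e13f9619ea9e; part 2 `…/LoadBearing.lean` p143399 @ d62cfc797c23; part 3
`…/NoChangeOfVariables.lean` p143989 @ 51bfcdd3c700; part 4 `…/LemniscaticWitness.lean` p143785 @
e00cb4fec9a0; part 5 `…/LemniscaticValue.lean` p143789 @ f75ac55e44a3; structural part `…/Core.lean`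
p143028 @ 4975519a636e; namespace `Summit.KontsevichZagierPeriods.IsogenyCertificates.BiellipticRealPeriodCellNegative`).
Statements (verbatim crux set `S`):
* `false_without_eval : ¬ ∀ c ∈ closure S, c ∈ KZ.relations`;
* `false_without_additivity : ¬ ∀ c ∈ closure S, eval c = 0 → c ∈ closure (changeOfVariablesRel ∪ newtonLeibnizRel)`;
* `false_without_cov_nl : ¬ ∀ c ∈ closure S, eval c = 0 → c ∈ closure (domainAddRel ∪ integrandAddRel)`;
* `not_value_ne_zero_of_nondegenerate : ¬ ∀ G q a₀ a₁ r, ⟨generator clauses⟩ → (a₀ ≠ 0 ∨ a₁ ≠ 0) → r.value ≠ 0`;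
* `exists_generator_value_pos`, `exists_kernel_single_ne_zero`, `exists_kernel_pair_ne_zero`;
* `false_without_changeOfVariables_of_transcendental (hT)` and, unconditionally (part 5),
  `false_without_changeOfVariables : ¬ ∀ c ∈ closure S, eval c = 0 → c ∈ closure (domainAddRel ∪ integrandAddRel ∪ newtonLeibnizRel)`.
Import the five modules to use them (this work file does not import them only because the seat-side
farm snapshot that must elaborate it lags the tree by more than a session). -/

/-! ## §5 Near-misses

None open at the end of cycle 1: the former near-miss (transcendence input of F6) was bypassed by
switching to the lemniscatic witness curve, whose period the tree's Huber–Wüstholz theorem reaches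
directly (part 5, `transcendental_halfLem`). For the FIRST witness curve `y² = −(x²−1)(x²−4)(x²−9)`
the transcendence of `∫₂³ dx/√F₀` remains unproved in the tree (it would follow the same way once the
egg of `E₂ : w² = −(1−v)(1−4v)(1−9v)` is identified with a lattice period); it is no longer needed.

Open questions recorded for later cycles (not refutations — the crux is summit-implied):
* is Newton–Leibniz (rule (3)) needed at all for this sector? (`KZ.coeffSum`/`dimZeroEval`-type
  invariants do not separate it here: all sector generators live in dimension `1`; the planned lines
  use only (1a), (1b), (2) plus the landed cell (i), whose own derivations should be inspected);
* the weakened statements of F2 (`withoutBoundedGens` etc.) are true iff Conjecture 1 holds on the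
  corresponding 1-motive sector — no cheaper status is known. -/

/-- Sanity restatement available in this work file without the new modules: rules (2)+(3) preserve the
coefficient sum, so a SINGLE generator of value `0` (the odd central generator of part 1, or any
`[K, x/√G(x²)]` on a central oval) is never in `closure((2) ∪ (3))` — the cheap half of F4.
[cite: KontsevichZagier2001, §1.2] -/
theorem single_generator_not_mem_closure_cov_nl (r : KZ.IntegralRep 1) :
    KZ.of r ∉ AddSubgroup.closure (KZ.changeOfVariablesRel ∪ KZ.newtonLeibnizRel) := fun h => by
  have hk := KZ.closure_cov_nl_le_ker_coeffSum h
  rw [AddMonoidHom.mem_ker, KZ.coeffSum_of] at hk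
  exact one_ne_zero hk

end Summit.KontsevichZagierPeriods.KontsevichZagierPeriods.Cruxes.BiellipticRealPeriodCell.Disproof
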